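import Literature.AlgebraicGeometry.Deformation.LocalHilbertFunctorTangentSheaf
import Literature.AlgebraicGeometry.Deformation.LocalHilbertFunctorSheafSupport
import Literature.AlgebraicGeometry.Deformation.LocalHilbertFunctorSmallExtensionCharts
import Literature.AlgebraicGeometry.HodgeTheory.NormalSheafAffineSections
import Literature.AlgebraicGeometry.Modules.SheafHomOfAffineTraces
import HarnessLib

/-!
# The tangent sheaf of the local Hilbert functor along a small extension IS the normal sheaf: `Hⁿ` transport

Topic `Literature/AlgebraicGeometry/Deformation`. THEOREMS and definitions WITH BODY only (no named fact, no `sorry`,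
no instance, no notation). Written for the literature-typing tranche LT-H1 «semiregularity consumers» (cell
`pub-hsemireg`): the last Literature input of the assembly discharging
`Deformation.Hartshorne2010_localHilbertFunctor_isSmooth_of_subsingleton_normalH1` ([Hartshorne2010, Cor. 6.3]).

[Hartshorne2010, Thm. 6.2 (a), proof p. 47]: «to show that the action of `H⁰(Y₀, 𝒩₀ ⊗_k J)` […] which is defined
locally, is a natural action, and that it glues together on the overlaps». For a closed immersion `ι₀ : Z → X` of
`k`-schemes with `X` locally Noetherian, a small extension `0 → J → C' → C → 0` with `J = k · t`, the sheaf of abelian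
groups `V ↦ H_{Z ∩ W}^{W}(k[J])`, `W = X ∖ ι₀(Z ∖ V)` on `Z` (`hilbTangentSheaf`, `LocalHilbertFunctorTangentSheaf.lean`)
and the normal sheaf `𝒩_{Z/X}` (`normalSheafAb ι₀`) have, over the traces `ι₀⁻¹U` of the AFFINE opens `U ⊆ X`, the
additive identifications

`H(k[J])(X ∖ ι₀(Z ∖ ι₀⁻¹U)) →(restriction, bijective) H_{Z ∩ U}^U(k[J]) ≃ Hom_A(I(U), A/I(U)) ≃ Γ(ι₀⁻¹U, 𝒩_{Z/X})`

(`localHilbertFunctor.resOver_bijective_of_support_subset` of `LocalHilbertFunctorSheafSupport.lean`;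
`localHilbertFunctor.secKerSectionsEquiv` of `LocalHilbertFunctorSmallExtensionCharts.lean` — Thm. 6.2 (a) ∕ Thm. 2.4 on
an affine piece; `HodgeTheory.normalSectionsEquiv` of `NormalSheafAffineSections.lean` — Prop. 2.3 ∕ Thm. 2.4), natural
along inclusions `U' ≤ U` of affine opens (`secKerSectionsEquiv_naturality`, `normalSectionsEquiv_map`). By
`Modules.AffineTraceHomData` (`SheafHomOfAffineTraces.lean`: morphisms of sheaves from data on the basis of affine traces)
they glue to an isomorphism of abelian sheaves, whence `Hⁿ(Z, T) = 0 ↔ Hⁿ(Z, 𝒩_{Z/X}) = 0`.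

* `hilbTangentNormalApp` — the composite identification over `ι₀⁻¹U`, `U` affine, as a morphism of `AddCommGrpCat`;
  `hilbTangentNormalApp_bijective`;
* `hilbTangentNormalData : AffineTraceHomData ι₀ (hilbTangentSheaf X ι₀ π hI aug) (normalSheafAb ι₀)` (naturality);
* `subsingleton_hilbTangentSheaf_H_iff` — `Hⁿ(Z, hilbTangentSheaf) = 0 ↔ Hⁿ(Z, 𝒩_{Z/X}) = 0`;
  `subsingleton_hilbTangentSheaf_H1_of_subsingleton_normalH1` — the input `hT` of lit-8's
  `localHilbertFunctor_isSmooth_of_isRegularImmersionOfCodim_of_subsingleton_hilbTangentSheaf_H1` from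
  `H¹(Z, 𝒩_{Z/X}) = 0`, for every small extension (`IsSmallExtension.exists_kerSubmodule_generator` of
  `LocalHilbertFunctorSmallExtensionAffine.lean`).

## What is NOT here

The statement `…_holds` itself (append protocol on `EmbeddedDeformationsVanishingNormalH1.lean`, which also needs the
«extensions exist locally» input from regular immersions).

## References

* [Hartshorne2010] R. Hartshorne, *Deformation Theory*, GTM 257 (2010): Thm. 2.4 and its proof (pp. 12–13), Thm. 6.2
  and its proof (pp. 46–49), Cor. 6.3 (pp. 49–50).
* [Schlessinger1968] M. Schlessinger, *Functors of Artin rings*, Trans. AMS 130 (1968), Lemma 2.10 and (2.17).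
* [StacksProject] The Stacks Project, Tag 009U (morphisms of sheaves from a basis).
-/

noncomputable section

-- as in `LocalHilbertFunctor.lean`: `(X ⊗ Spec R).left` unfolds to a pullback only at default transparency
set_option backward.isDefEq.respectTransparency false -- `CategoryTheory.Monoidal.Cartesian.Over` itself

open CategoryTheory Limits MonoidalCategory Opposite AlgebraicGeometry Scheme.IdealSheafData TensorProduct IsLocalRing
  TopologicalSpace Topology
open Literature.AlgebraicGeometry.HodgeTheory (normalSectionsEquiv normalSectionsEquiv_map linearMap_ext_of_resIdeal
  resIdeal resQuot preimage_le)
open Literature.AlgebraicGeometry.Modules (AffineTraceHomData preimageAffineOpen)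

universe u

namespace Literature.AlgebraicGeometry.Deformation

section App

variable {k : Type u} [Field k] (X : Motives.SchemeOver k) {Z : Scheme.{u}} (ι₀ : Z ⟶ X.left) [IsClosedImmersion ι₀]
  {A' A : ArtAlg.{u} k} (π : A' →ₐ[k] A) (hI : RingHom.ker π * maximalIdeal A' = ⊥) (aug : ↥A' →ₐ[k] k)
  (t : ↥(ArtAlg.kerSubmodule π)) (ht : (t : ↥A') ≠ 0) (hts : ∀ j : ↥(ArtAlg.kerSubmodule π), ∃ b : k, j = b • t)

/-- `U ⊆ X ∖ ι₀(Z ∖ ι₀⁻¹U)`. [cite: Hartshorne2010, proof of Thm. 6.2 (b), p. 49] -/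
theorem le_satOpen_preimage (U : X.left.Opens) : U ≤ satOpen X ι₀ (ι₀ ⁻¹ᵁ U) :=
  le_saturateOpen_of_forall_mem ι₀.isClosedEmbedding fun _ hx => hx

/-- Every point of `Z` lying in `X ∖ ι₀(Z ∖ ι₀⁻¹U)` lies in `U` (the two opens have the same trace on `Z`).
[cite: Hartshorne2010, proof of Thm. 6.2 (b), p. 49] -/
theorem mem_of_mem_satOpen_preimage_of_mem_support (U : X.left.Opens) :
    ∀ x ∈ satOpen X ι₀ (ι₀ ⁻¹ᵁ U), x ∈ ι₀.ker.support → x ∈ U := by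
  intro x hxW hxs
  have hf := ι₀.isClosedEmbedding
  have hxs' : x ∈ (ι₀.ker.support : Set X.left) := hxs
  rw [Scheme.Hom.support_ker, hf.isClosed_range.closure_eq] at hxs'
  obtain ⟨z', rfl⟩ := hxs'
  exact (mem_saturateOpen_iff hf).mp hxW z' rfl

/-- **Restriction `H(k[J])(X ∖ ι₀(Z ∖ ι₀⁻¹U)) → H_{Z ∩ U}^U(k[J])` is a bijection** (embedded deformations of `Z` are
determined near `Z`: `localHilbertFunctor.resOver_bijective_of_support_subset`). [cite: Hartshorne2010, proof of
Thm. 6.2 (b), p. 49, with §2 pp. 11–12] -/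
theorem resOver_satOpen_preimage_bijective (U : X.left.Opens) (R : ArtAlg.{u} k) :
    Function.Bijective (localHilbertFunctor.resOver (I₀ := ι₀.ker) (R := R) (le_satOpen_preimage X ι₀ U)) :=
  localHilbertFunctor.resOver_bijective_of_support_subset (I₀ := ι₀.ker) (R := R) (le_satOpen_preimage X ι₀ U)
    (mem_of_mem_satOpen_preimage_of_mem_support X ι₀ U)

variable [IsLocallyNoetherian X.left]

/-- **The identification `H(k[J])(X ∖ ι₀(Z ∖ ι₀⁻¹U)) → Γ(ι₀⁻¹U, 𝒩_{Z/X})` over the trace of an affine open `U ⊆ X`**,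
as a plain function: restrict to `U`, identify with `Hom_A(I(U), A/I(U))` (Thm. 6.2 (a) on the affine piece, `J = k · t`),
identify with the sections of the normal sheaf (Thm. 2.4). Definition with body.
[cite: Hartshorne2010, proof of Thm. 6.2 (a), p. 47, with Thm. 2.4 (pp. 12–13)] -/
def hilbTangentNormalFun (U : X.left.affineOpens)
    (s : localHilbertFunctor.secOver X ι₀.ker (ArtAlg.sqZeroKer π hI) (satOpen X ι₀ (ι₀ ⁻¹ᵁ (U : X.left.Opens)))) :
    Γ(HodgeTheory.normalSheaf ι₀, ι₀ ⁻¹ᵁ (U : X.left.Opens)) :=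
  letI := localHilbertFunctor.kerAddCommGroup (openOver X U.1) (ι₀.ker.comap U.1.ι) π hI aug
  (normalSectionsEquiv ι₀ U).symm
    (localHilbertFunctor.secKerSectionsEquiv X ι₀.ker U π hI aug t ht hts
      (localHilbertFunctor.resOver (le_satOpen_preimage X ι₀ U.1) s))

/-- Unfolding `hilbTangentNormalFun`. [cite: Hartshorne2010, proof of Thm. 6.2 (a), p. 47] -/
theorem hilbTangentNormalFun_def (U : X.left.affineOpens)
    (s : localHilbertFunctor.secOver X ι₀.ker (ArtAlg.sqZeroKer π hI) (satOpen X ι₀ (ι₀ ⁻¹ᵁ (U : X.left.Opens)))) :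
    letI := localHilbertFunctor.kerAddCommGroup (openOver X U.1) (ι₀.ker.comap U.1.ι) π hI aug
    hilbTangentNormalFun X ι₀ π hI aug t ht hts U s =
      (normalSectionsEquiv ι₀ U).symm
        (localHilbertFunctor.secKerSectionsEquiv X ι₀.ker U π hI aug t ht hts
          (localHilbertFunctor.resOver (le_satOpen_preimage X ι₀ U.1) s)) :=
  rfl

/-- The identification is additive (restriction is additive, `resOver_add`; the two equivalences are additive).
[cite: Hartshorne2010, proof of Thm. 6.2 (a), p. 47] [cite: Schlessinger1968, (2.17)] -/
theorem hilbTangentNormalFun_add (U : X.left.affineOpens)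
    (s s' : localHilbertFunctor.secOver X ι₀.ker (ArtAlg.sqZeroKer π hI) (satOpen X ι₀ (ι₀ ⁻¹ᵁ (U : X.left.Opens)))) :
    letI := localHilbertFunctor.kerAddCommGroup (openOver X (satOpen X ι₀ (ι₀ ⁻¹ᵁ (U : X.left.Opens))))
      (ι₀.ker.comap (satOpen X ι₀ (ι₀ ⁻¹ᵁ (U : X.left.Opens))).ι) π hI aug
    hilbTangentNormalFun X ι₀ π hI aug t ht hts U (s + s') =
      hilbTangentNormalFun X ι₀ π hI aug t ht hts U s + hilbTangentNormalFun X ι₀ π hI aug t ht hts U s' := by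
  letI := localHilbertFunctor.kerAddCommGroup (openOver X (satOpen X ι₀ (ι₀ ⁻¹ᵁ (U : X.left.Opens))))
    (ι₀.ker.comap (satOpen X ι₀ (ι₀ ⁻¹ᵁ (U : X.left.Opens))).ι) π hI aug
  letI := localHilbertFunctor.kerAddCommGroup (openOver X U.1) (ι₀.ker.comap U.1.ι) π hI aug
  rw [hilbTangentNormalFun_def, hilbTangentNormalFun_def, hilbTangentNormalFun_def,
    localHilbertFunctor.resOver_add X ι₀.ker π hI aug (le_satOpen_preimage X ι₀ U.1) s s', map_add, map_add]

/-- The identification is a bijection. [cite: Hartshorne2010, proof of Thm. 6.2 (a), p. 47, with Thm. 2.4] -/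
theorem hilbTangentNormalFun_bijective (U : X.left.affineOpens) :
    Function.Bijective (hilbTangentNormalFun X ι₀ π hI aug t ht hts U) :=
  letI := localHilbertFunctor.kerAddCommGroup (openOver X U.1) (ι₀.ker.comap U.1.ι) π hI aug
  (normalSectionsEquiv ι₀ U).symm.bijective.comp
    ((localHilbertFunctor.secKerSectionsEquiv X ι₀.ker U π hI aug t ht hts).bijective.comp
      (resOver_satOpen_preimage_bijective X ι₀ U.1 (ArtAlg.sqZeroKer π hI)))

/-- **The identification over `ι₀⁻¹U` as a morphism of abelian groups** `T(ι₀⁻¹U) → 𝒩_{Z/X}(ι₀⁻¹U)`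
(`T = hilbTangentSheaf`, whose value at `V` is `H^{X ∖ ι₀(Z ∖ V)}(k[J])` with Schlessinger's group structure; the abelian
sheaf `normalSheafAb ι₀` underlying `𝒩_{Z/X}`, whose sections ARE `Γ(-, normalSheaf ι₀)`). Definition with body.
[cite: Hartshorne2010, proof of Thm. 6.2 (a), p. 47] -/
def hilbTangentNormalApp (U : X.left.affineOpens) :
    (hilbTangentSheaf X ι₀ π hI aug).obj.obj (op (preimageAffineOpen ι₀ U)) ⟶
      (normalSheafAb ι₀).obj.obj (op (preimageAffineOpen ι₀ U)) :=
  letI := localHilbertFunctor.kerAddCommGroup (openOver X (satOpen X ι₀ (ι₀ ⁻¹ᵁ (U : X.left.Opens))))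
    (ι₀.ker.comap (satOpen X ι₀ (ι₀ ⁻¹ᵁ (U : X.left.Opens))).ι) π hI aug
  AddCommGrpCat.ofHom
    { toFun := hilbTangentNormalFun X ι₀ π hI aug t ht hts U
      map_zero' := by
        have h := hilbTangentNormalFun_add X ι₀ π hI aug t ht hts U 0 0
        rw [add_zero] at h
        exact left_eq_add.mp h
      map_add' := hilbTangentNormalFun_add X ι₀ π hI aug t ht hts U }

/-- On elements the morphism is `hilbTangentNormalFun`. [cite: Hartshorne2010, proof of Thm. 6.2 (a), p. 47] -/
theorem hilbTangentNormalApp_apply (U : X.left.affineOpens)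
    (s : (hilbTangentSheaf X ι₀ π hI aug).obj.obj (op (preimageAffineOpen ι₀ U))) :
    hilbTangentNormalApp X ι₀ π hI aug t ht hts U s = hilbTangentNormalFun X ι₀ π hI aug t ht hts U s :=
  rfl

/-- The morphism is a bijection. [cite: Hartshorne2010, proof of Thm. 6.2 (a), p. 47] -/
theorem hilbTangentNormalApp_bijective (U : X.left.affineOpens) :
    Function.Bijective (hilbTangentNormalApp X ι₀ π hI aug t ht hts U) :=
  hilbTangentNormalFun_bijective X ι₀ π hI aug t ht hts U

/-- **Naturality along affine `U' ≤ U`** («the action … is a natural action … it glues together on the overlaps»): the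
identifications commute with restriction — from `secKerSectionsEquiv_naturality` (tangent side) and
`normalSectionsEquiv_map` (normal side), both computed on `I(U)|_{U'}`, which generates `I(U')`
(`linearMap_ext_of_resIdeal`). [cite: Hartshorne2010, proof of Thm. 6.2 (a), p. 47, and §2 p. 13] -/
theorem hilbTangentNormalFun_resOver {U U' : X.left.affineOpens} (h : U' ≤ U)
    (s : localHilbertFunctor.secOver X ι₀.ker (ArtAlg.sqZeroKer π hI) (satOpen X ι₀ (ι₀ ⁻¹ᵁ (U : X.left.Opens)))) :
    hilbTangentNormalFun X ι₀ π hI aug t ht hts U'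
        (localHilbertFunctor.resOver
          (saturateOpen_mono ι₀.isClosedEmbedding (Scheme.Hom.preimage_mono ι₀ h)) s) =
      (HodgeTheory.normalSheaf ι₀).presheaf.map (homOfLE (preimage_le ι₀ h)).op
        (hilbTangentNormalFun X ι₀ π hI aug t ht hts U s) := by
  letI := localHilbertFunctor.kerAddCommGroup (openOver X U.1) (ι₀.ker.comap U.1.ι) π hI aug
  letI := localHilbertFunctor.kerAddCommGroup (openOver X U'.1) (ι₀.ker.comap U'.1.ι) π hI aug
  rw [hilbTangentNormalFun_def, hilbTangentNormalFun_def]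
  apply (normalSectionsEquiv ι₀ U').injective
  rw [AddEquiv.apply_symm_apply]
  apply linearMap_ext_of_resIdeal ι₀ h
  intro x
  rw [normalSectionsEquiv_map, AddEquiv.apply_symm_apply, localHilbertFunctor.resOver_resOver,
    ← localHilbertFunctor.resOver_resOver (show (U' : X.left.Opens) ≤ U from h) (le_satOpen_preimage X ι₀ U.1)]
  exact localHilbertFunctor.secKerSectionsEquiv_naturality X ι₀.ker h π hI aug t ht hts _ x

/-- **The chart data**: bijective identifications `T(ι₀⁻¹U) ≅ 𝒩_{Z/X}(ι₀⁻¹U)` over the traces of the affine opens, natural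
along affine inclusions (`Modules.AffineTraceHomData`). Definition with body.
[cite: Hartshorne2010, proof of Thm. 6.2 (a), p. 47, and §2 p. 13] [cite: StacksProject, Tag 009U] -/
def hilbTangentNormalData : AffineTraceHomData ι₀ (hilbTangentSheaf X ι₀ π hI aug) (normalSheafAb ι₀) where
  app := hilbTangentNormalApp X ι₀ π hI aug t ht hts
  naturality {U U'} h := by
    refine AddCommGrpCat.ext fun s => ?_
    exact hilbTangentNormalFun_resOver X ι₀ π hI aug t ht hts h s

include t ht hts in
/-- **`Hⁿ(Z, T) = 0 ↔ Hⁿ(Z, 𝒩_{Z/X}) = 0`** for the tangent sheaf `T = hilbTangentSheaf X ι₀ π hI aug` of the local Hilbert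
functor along `π` with `J = ker π = k · t` a line killed by `𝔪` (the hypotheses `t`, `ht`, `hts`): the chart data glue to
an isomorphism of abelian sheaves on `Z` (`AffineTraceHomData.subsingleton_H_iff`).
[cite: Hartshorne2010, Thm. 6.2 (a) and Cor. 6.3, pp. 47–50] [cite: StacksProject, Tag 009U] -/
theorem subsingleton_hilbTangentSheaf_H_iff (n : ℕ) :
    Subsingleton ((hilbTangentSheaf X ι₀ π hI aug).H n) ↔ Subsingleton ((normalSheafAb ι₀).H n) :=
  (hilbTangentNormalData X ι₀ π hI aug t ht hts).subsingleton_H_iff ι₀.isClosedEmbedding.isInducing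
    (hilbTangentNormalApp_bijective X ι₀ π hI aug t ht hts) n

/-- **`H¹(Z, 𝒩_{Z/X}) = 0 ⇒ H¹(Z, T_π) = 0` for EVERY small extension `π`** — the hypothesis `hT` of
`localHilbertFunctor_isSmooth_of_isRegularImmersionOfCodim_of_subsingleton_hilbTangentSheaf_H1` (lit-8 FILE 4), from
the vanishing of `H¹` of the normal sheaf. [cite: Hartshorne2010, Cor. 6.3 (pp. 49–50), via Thm. 6.2 (a)(b)] -/
theorem subsingleton_hilbTangentSheaf_H1_of_subsingleton_normalH1 (hπ : IsSmallExtension k π)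
    (h1 : Subsingleton ((normalSheafAb ι₀).H 1)) :
    Subsingleton ((hilbTangentSheaf X ι₀ π hπ.ker_mul_maximalIdeal aug).H 1) := by
  obtain ⟨t, ht, hts⟩ := hπ.exists_kerSubmodule_generator
  exact (subsingleton_hilbTangentSheaf_H_iff X ι₀ π hπ.ker_mul_maximalIdeal aug t ht hts 1).mpr h1

end App

end Literature.AlgebraicGeometry.Deformation

end
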